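import Literature.Analysis.Calculus.AnalyticOfDerivBound
import HarnessLib

/-!
# Analytic vectors of a one-parameter group from factorial bounds on the derivatives

Let `E` be a real Banach space and `U : ℝ → (E →L[ℝ] E)` a uniformly bounded one-parameter
family of continuous linear maps with `U (s + t) = U s ∘ U t` (e.g. a unitary one-parameter group
of a Hilbert space). If `w₀, w₁, w₂, …` is a sequence of vectors such that `t ↦ U t w_k` has
derivative `w_{k+1}` at `t = 0` (so `w_k` is "the `k`-th derivative `Aᵏ w₀`" of the orbit of `w₀`
along the generator) and `‖w_k‖ ≤ C Mᵏ k!`, then the orbit `t ↦ U t w₀` is REAL ANALYTIC at every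
point of `ℝ` (`analyticAt_oneParam_apply_of_norm_le`): its `k`-th derivative is `t ↦ U t w_k`
(`iteratedDeriv_oneParam_apply`), bounded by `B C Mᵏ k!` uniformly in `t`, and a smooth
Banach-valued function of one real variable with such bounds is analytic
(`Literature.Analysis.Calculus.analyticAt_of_norm_iteratedDeriv_le`, Taylor's formula). This is
the passage from Nelson's estimate `‖Xᵏ v‖ ≤ C Mᵏ k!` (Nelson 1959, Lemma 5.1 and Thm. 3:
analytic vectors in the sense of absolutely convergent exponential series) to Harish-Chandra's
well-behaved vectors along a one-parameter subgroup (Harish-Chandra 1953, §7: `t ↦ π(exp tX) ψ`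
analytic), in the form consumed by `Literature/NumberTheory/Automorphic` (analyticity of the
`L²`-orbits of `K`-finite `Z(𝔤)`-finite cusp forms).

Everything here is proved; there is no definition.

## References

* E. Nelson, *Analytic vectors*, Ann. of Math. 70 (1959), 572–615, §2 and Lemma 5.1
  [Nelson1959] (not held).
* Harish-Chandra, *Representations of a semisimple Lie group on a Banach space. I*, Trans. AMS 75
  (1953), 185–243, §7 (well-behaved vectors; Thm. 2) [HarishChandraTAMS1953] (held).
-/

open scoped Topology ContDiff Nat

noncomputable section

namespace Literature.Analysis.OperatorTheory

variable {E : Type*} [NormedAddCommGroup E] [NormedSpace ℝ E]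

/-- **Derivative of an orbit of a one-parameter family at a general point.** If
`U (s + t) = U s ∘ U t` and `t ↦ U t v` has derivative `v'` at `0`, then it has derivative
`U t v'` at `t` (`U (t + τ) v - U t v = U t (U τ v - U 0 v)` and `U t` is continuous linear).
Harish-Chandra 1953, §7 (`π(y) ψ` is well-behaved with `ψ`). [folklore] -/
theorem hasDerivAt_oneParam_apply (U : ℝ → E →L[ℝ] E) (hU : ∀ s t v, U (s + t) v = U s (U t v))
    {v v' : E} (hd : HasDerivAt (fun t ↦ U t v) v' 0) (t : ℝ) :
    HasDerivAt (fun s ↦ U s v) (U t v') t := by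
  rw [hasDerivAt_iff_tendsto_slope_zero] at hd ⊢
  have h := ((U t).continuous.tendsto v').comp hd
  refine h.congr fun τ ↦ ?_
  show U t (τ⁻¹ • (U (0 + τ) v - U 0 v)) = τ⁻¹ • (U (t + τ) v - U t v)
  rw [zero_add, map_smul, map_sub, ← hU, ← hU, add_zero]

/-- **The iterated derivatives of an orbit.** If `t ↦ U t w_k` has derivative `w_{k+1}` at `0`
for every `k`, then the `k`-th derivative of the orbit `t ↦ U t w₀` is `t ↦ U t w_k`
(induction, `hasDerivAt_oneParam_apply`). Harish-Chandra 1953, §7, proof of Thm. 2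
(`(d/du)^m π(exp uX) ψ = π(exp uX) π_W(X^m) ψ`). [cite: HarishChandraTAMS1953, §7, Thm. 2 (proof, p. 210)] -/
theorem iteratedDeriv_oneParam_apply (U : ℝ → E →L[ℝ] E)
    (hU : ∀ s t v, U (s + t) v = U s (U t v)) (w : ℕ → E)
    (hw : ∀ k, HasDerivAt (fun t ↦ U t (w k)) (w (k + 1)) 0) (k : ℕ) :
    iteratedDeriv k (fun t ↦ U t (w 0)) = fun t ↦ U t (w k) := by
  induction k with
  | zero => exact iteratedDeriv_zero
  | succ k ih =>
    rw [iteratedDeriv_succ, ih]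
    funext t
    exact (hasDerivAt_oneParam_apply U hU (hw k) t).deriv

/-- Under the same hypothesis the orbit `t ↦ U t w₀` is `C^∞` (all its iterated derivatives are
orbits, hence differentiable). [folklore] -/
theorem contDiff_oneParam_apply (U : ℝ → E →L[ℝ] E)
    (hU : ∀ s t v, U (s + t) v = U s (U t v)) (w : ℕ → E)
    (hw : ∀ k, HasDerivAt (fun t ↦ U t (w k)) (w (k + 1)) 0) :
    ContDiff ℝ ∞ (fun t ↦ U t (w 0)) :=
  Literature.Analysis.Calculus.contDiff_infty_of_differentiable_iteratedDeriv fun k ↦ by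
    rw [iteratedDeriv_oneParam_apply U hU w hw k]
    exact fun t ↦ (hasDerivAt_oneParam_apply U hU (hw k) t).differentiableAt

/-- **Factorial bounds on the derivatives make the orbit analytic.** Let `U : ℝ → (E →L[ℝ] E)`
satisfy `U (s + t) = U s ∘ U t` and `‖U t v‖ ≤ B ‖v‖` for all `t`, on the real Banach space
`E`; let `w : ℕ → E` satisfy `d/dt|₀ U t w_k = w_{k+1}` and `‖w_k‖ ≤ C Mᵏ k!` for all `k`. Then
`t ↦ U t w₀` is real analytic at every `t₀ ∈ ℝ`: its `k`-th derivative `t ↦ U t w_k`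
(`iteratedDeriv_oneParam_apply`) has norm at most `(B C) Mᵏ k!`, and
`Literature.Analysis.Calculus.analyticAt_of_norm_iteratedDeriv_le` applies. Nelson 1959, §2
(analytic vectors: `∑ ‖Xᵏ v‖ sᵏ / k! < ∞`) and Lemma 5.1; Harish-Chandra 1953, §7, Thm. 2
(conversely, orbits of well-behaved vectors are such exponential series). [cite: HarishChandraTAMS1953, §7, Thm. 2 (pp. 209–210)] -/
theorem analyticAt_oneParam_apply_of_norm_le [CompleteSpace E] (U : ℝ → E →L[ℝ] E)
    (hU : ∀ s t v, U (s + t) v = U s (U t v)) {B : ℝ} (hB : ∀ t v, ‖U t v‖ ≤ B * ‖v‖)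
    (w : ℕ → E) (hw : ∀ k, HasDerivAt (fun t ↦ U t (w k)) (w (k + 1)) 0)
    {C M : ℝ} (hb : ∀ k, ‖w k‖ ≤ C * M ^ k * k !) (t₀ : ℝ) :
    AnalyticAt ℝ (fun t ↦ U t (w 0)) t₀ := by
  -- replace `B` by `max B 0 ≥ 0`
  have hB' : ∀ t v, ‖U t v‖ ≤ max B 0 * ‖v‖ := fun t v ↦
    (hB t v).trans (mul_le_mul_of_nonneg_right (le_max_left _ _) (norm_nonneg _))
  refine Literature.Analysis.Calculus.analyticAt_of_norm_iteratedDeriv_le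
    (contDiff_oneParam_apply U hU w hw) (M := max B 0 * C) (C := M) (fun k t ↦ ?_) t₀
  rw [iteratedDeriv_oneParam_apply U hU w hw k]
  calc ‖U t (w k)‖ ≤ max B 0 * ‖w k‖ := hB' t (w k)
    _ ≤ max B 0 * (C * M ^ k * k !) := mul_le_mul_of_nonneg_left (hb k) (le_max_right _ _)
    _ = max B 0 * C * M ^ k * k ! := by ring

end Literature.Analysis.OperatorTheory
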